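import Mathlib.Data.Nat.Choose.Basic
import Mathlib.Data.Nat.Choose.Sum
import Mathlib.Data.Nat.Choose.Vandermonde
import Mathlib.Algebra.BigOperators.Intervals
import Mathlib.Algebra.Order.BigOperators.Group.Finset
import Mathlib.Tactic
import HarnessLib

/-!
# Moments of the hypergeometric law (for step (B2) of the CORE-LEMMA proof)

Support file for the Sahi / Conjecture-P programme of route `PercNearOneGluingNoHeavy`
(`--supports stmt-CriticalPhenomena-4575`, prover prim-l12-p5 gen 27; proof notes
`prim-l12-p5/CORE-g26.md` §5.5 and `prim-l12-p5/PROOF-DF1-g26.md` §3.5).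
No definitions, no named facts, no sorries.

For `X ~ Hyp(n+m; n; K)` (marked items among `K` drawn from `n+m`, `n` marked) the unnormalised
law is `k ↦ C(n,k) C(m,K-k)`; this file proves, over `ℝ` and by Vandermonde's identity
(`Nat.add_choose_eq`) with index shifts,

* `vandermonde` : `∑_k C(n,k)C(m,K-k) = C(n+m,K)`;
* `first_moment` : `(n+m) ∑_k k C(n,k)C(m,K-k) = nK ∑_k C(n,k)C(m,K-k)`;
* `second_fact_moment` : `(n+m)(n+m-1) ∑_k k(k-1) C(n,k)C(m,K-k) = n(n-1)K(K-1) ∑_k C(n,k)C(m,K-k)`;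
* `hyp_second_moment` : for the HALF sample `n₁ + n₂ = 2K`,
  `(n₁+n₂-1) ∑_k C(n₁,k)C(n₂,K-k)(2k-n₁)² = n₁n₂ ∑_k C(n₁,k)C(n₂,K-k)`, i.e.
  `E[(2X-n₁)²] = 4 Var X = n₁n₂/(n₁+n₂-1)` — the constant of step (B2) of the note.
-/

namespace Summit.CriticalPhenomena.PercolationContinuityZ3.Theorems

namespace HypMoments

open Finset

/-- Vandermonde's identity over `ℝ`: `∑_{k ≤ K} C(n,k) C(m,K-k) = C(n+m,K)`. -/
theorem vandermonde (n m K : ℕ) :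
    ∑ k ∈ range (K + 1), (n.choose k : ℝ) * (m.choose (K - k) : ℝ) = ((n + m).choose K : ℝ) := by
  have h := Nat.add_choose_eq n m K
  rw [Finset.Nat.sum_antidiagonal_eq_sum_range_succ_mk] at h
  rw [h]
  push_cast
  rfl

/-- First moment: `(n+m) · ∑ k C(n,k)C(m,K-k) = n K · ∑ C(n,k)C(m,K-k)`. -/
theorem first_moment (n m K : ℕ) :
    ((n : ℝ) + m) * ∑ k ∈ range (K + 1), (k : ℝ) * (n.choose k : ℝ) * (m.choose (K - k) : ℝ) =
      (n : ℝ) * K * ∑ k ∈ range (K + 1), (n.choose k : ℝ) * (m.choose (K - k) : ℝ) := by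
  rw [vandermonde]
  rcases Nat.eq_zero_or_pos n with hn | hn
  · subst hn
    have hz : ∑ k ∈ range (K + 1), (k : ℝ) * ((0 : ℕ).choose k : ℝ) * (m.choose (K - k) : ℝ) = 0 := by
      refine sum_eq_zero fun k _ => ?_
      rcases Nat.eq_zero_or_pos k with hk | hk
      · subst hk
        simp
      · rw [Nat.choose_eq_zero_of_lt hk]
        simp
    rw [hz]
    simp
  rcases Nat.eq_zero_or_pos K with hK | hK
  · subst hK
    simp
  obtain ⟨n', rfl⟩ : ∃ n', n = n' + 1 := ⟨n - 1, by omega⟩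
  obtain ⟨K', rfl⟩ : ∃ K', K = K' + 1 := ⟨K - 1, by omega⟩
  -- peel off k = 0 and shift
  rw [sum_range_succ']
  simp only [Nat.cast_zero, zero_mul, add_zero]
  have hshift : ∀ k ∈ range (K' + 1), ((k + 1 : ℕ) : ℝ) * ((n' + 1).choose (k + 1) : ℝ) *
      (m.choose (K' + 1 - (k + 1)) : ℝ) = ((n' : ℝ) + 1) * ((n'.choose k : ℝ) * (m.choose (K' - k) : ℝ)) := by
    intro k _
    have h := Nat.add_one_mul_choose_eq n' k
    have hc : (((n' + 1) * n'.choose k : ℕ) : ℝ) = (((n' + 1).choose (k + 1) * (k + 1) : ℕ) : ℝ) := by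
      rw [h]
    push_cast at hc
    have e : K' + 1 - (k + 1) = K' - k := by omega
    rw [e]
    push_cast
    linear_combination (m.choose (K' - k) : ℝ) * (-hc)
  rw [sum_congr rfl hshift, ← mul_sum, vandermonde]
  -- (n'+1+m) * ((n'+1) * C(n'+m, K')) = (n'+1) (K'+1) C(n'+1+m, K'+1)
  have h2 := Nat.add_one_mul_choose_eq (n' + m) K'
  have hc2 : (((n' + m + 1) * (n' + m).choose K' : ℕ) : ℝ) =
      (((n' + m + 1).choose (K' + 1) * (K' + 1) : ℕ) : ℝ) := by rw [h2]
  push_cast at hc2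
  have e2 : n' + 1 + m = n' + m + 1 := by ring
  rw [e2]
  push_cast
  linear_combination ((n' : ℝ) + 1) * hc2

/-- Second factorial moment:
`(n+m)(n+m-1) · ∑ k(k-1) C(n,k)C(m,K-k) = n(n-1)K(K-1) · ∑ C(n,k)C(m,K-k)`. -/
theorem second_fact_moment (n m K : ℕ) :
    ((n : ℝ) + m) * ((n : ℝ) + m - 1) *
        ∑ k ∈ range (K + 1), (k : ℝ) * ((k : ℝ) - 1) * (n.choose k : ℝ) * (m.choose (K - k) : ℝ) =
      (n : ℝ) * ((n : ℝ) - 1) * K * ((K : ℝ) - 1) *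
        ∑ k ∈ range (K + 1), (n.choose k : ℝ) * (m.choose (K - k) : ℝ) := by
  rw [vandermonde]
  -- if n ≤ 1 or K ≤ 1 every term vanishes
  by_cases hsmall : n ≤ 1 ∨ K ≤ 1
  · have hzero : ∑ k ∈ range (K + 1), (k : ℝ) * ((k : ℝ) - 1) * (n.choose k : ℝ) *
        (m.choose (K - k) : ℝ) = 0 := by
      refine sum_eq_zero fun k hk => ?_
      have hkK : k ≤ K := by
        have := mem_range.mp hk
        omega
      rcases hsmall with hn | hK
      · -- n ≤ 1: either k ≤ 1 (factor k(k-1) = 0) or C(n,k) = 0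
        rcases Nat.lt_or_ge k 2 with hk2 | hk2
        · interval_cases k <;> simp
        · rw [Nat.choose_eq_zero_of_lt (show n < k by omega)]
          simp
      · have hk2 : k < 2 := by omega
        interval_cases k <;> simp
    rw [hzero, mul_zero]
    rcases hsmall with hn | hK
    · rcases Nat.lt_or_ge n 2 with hn2 | hn2
      · interval_cases n <;> simp
      · omega
    · rcases Nat.lt_or_ge K 2 with hK2 | hK2
      · interval_cases K <;> simp
      · omega
  push Not at hsmall
  obtain ⟨n', rfl⟩ : ∃ n', n = n' + 2 := ⟨n - 2, by omega⟩
  obtain ⟨K', rfl⟩ : ∃ K', K = K' + 2 := ⟨K - 2, by omega⟩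
  -- peel off k = 0, 1 and shift by two
  rw [sum_range_succ', sum_range_succ']
  have hf0 : ((0 : ℕ) : ℝ) * (((0 : ℕ) : ℝ) - 1) * ((n' + 2).choose 0 : ℝ) *
      (m.choose (K' + 2 - 0) : ℝ) = 0 := by simp
  have hf1 : ((0 + 1 : ℕ) : ℝ) * (((0 + 1 : ℕ) : ℝ) - 1) * ((n' + 2).choose (0 + 1) : ℝ) *
      (m.choose (K' + 2 - (0 + 1)) : ℝ) = 0 := by simp
  rw [hf0, hf1, add_zero, add_zero]
  have hshift : ∀ k ∈ range (K' + 1), ((k + 1 + 1 : ℕ) : ℝ) * (((k + 1 + 1 : ℕ) : ℝ) - 1) *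
      ((n' + 2).choose (k + 1 + 1) : ℝ) * (m.choose (K' + 2 - (k + 1 + 1)) : ℝ) =
      (((n' : ℝ) + 2) * ((n' : ℝ) + 1)) * ((n'.choose k : ℝ) * (m.choose (K' - k) : ℝ)) := by
    intro k _
    have h1 := Nat.add_one_mul_choose_eq (n' + 1) (k + 1)
    have h0 := Nat.add_one_mul_choose_eq n' k
    have hc1 : (((n' + 1 + 1) * (n' + 1).choose (k + 1) : ℕ) : ℝ) =
        (((n' + 1 + 1).choose (k + 1 + 1) * (k + 1 + 1) : ℕ) : ℝ) := by rw [h1]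
    have hc0 : (((n' + 1) * n'.choose k : ℕ) : ℝ) =
        (((n' + 1).choose (k + 1) * (k + 1) : ℕ) : ℝ) := by rw [h0]
    push_cast at hc1 hc0
    have e : K' + 2 - (k + 1 + 1) = K' - k := by omega
    have e2 : n' + 2 = n' + 1 + 1 := by ring
    rw [e, e2]
    push_cast
    linear_combination (m.choose (K' - k) : ℝ) * (-((k : ℝ) + 1) * hc1 - ((n' : ℝ) + 2) * hc0)
  rw [sum_congr rfl hshift, ← mul_sum, vandermonde]
  -- (N)(N-1) (n'+2)(n'+1) C(n'+m, K') = (n'+2)(n'+1)(K'+2)(K'+1) C(N, K'+2), N = n'+2+m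
  have h2 := Nat.add_one_mul_choose_eq (n' + m) K'
  have h3 := Nat.add_one_mul_choose_eq (n' + m + 1) (K' + 1)
  have hc2 : (((n' + m + 1) * (n' + m).choose K' : ℕ) : ℝ) =
      (((n' + m + 1).choose (K' + 1) * (K' + 1) : ℕ) : ℝ) := by rw [h2]
  have hc3 : (((n' + m + 1 + 1) * (n' + m + 1).choose (K' + 1) : ℕ) : ℝ) =
      (((n' + m + 1 + 1).choose (K' + 1 + 1) * (K' + 1 + 1) : ℕ) : ℝ) := by rw [h3]
  push_cast at hc2 hc3
  have e3 : n' + 2 + m = n' + m + 1 + 1 := by ring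
  have e4 : K' + 2 = K' + 1 + 1 := by ring
  rw [e3, e4]
  push_cast
  linear_combination (((n' : ℝ) + 2) * ((n' : ℝ) + 1)) * (((n' : ℝ) + m + 2) * hc2 + ((K' : ℝ) + 1) * hc3)

/-- **Second moment of the half-sample hypergeometric law.**  For `n₁ + n₂ = 2K`,
`(n₁+n₂-1) · ∑_k C(n₁,k)C(n₂,K-k)(2k-n₁)² = n₁ n₂ · ∑_k C(n₁,k)C(n₂,K-k)`, i.e.
`E[(2X-n₁)²] = n₁n₂/(N-1)` (`4·Var X`) for `X ~ Hyp(N; n₁; N/2)`. -/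
theorem hyp_second_moment (n₁ n₂ K : ℕ) (hN : n₁ + n₂ = 2 * K) :
    ((n₁ : ℝ) + n₂ - 1) * ∑ k ∈ range (K + 1),
        (n₁.choose k : ℝ) * (n₂.choose (K - k) : ℝ) * (2 * (k : ℝ) - n₁) ^ 2 =
      (n₁ : ℝ) * n₂ * ∑ k ∈ range (K + 1), (n₁.choose k : ℝ) * (n₂.choose (K - k) : ℝ) := by
  set S0 := ∑ k ∈ range (K + 1), (n₁.choose k : ℝ) * (n₂.choose (K - k) : ℝ) with hS0
  set S1 := ∑ k ∈ range (K + 1), (k : ℝ) * (n₁.choose k : ℝ) * (n₂.choose (K - k) : ℝ) with hS1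
  set S2 := ∑ k ∈ range (K + 1), (k : ℝ) * ((k : ℝ) - 1) * (n₁.choose k : ℝ) *
    (n₂.choose (K - k) : ℝ) with hS2
  have hsq : ∑ k ∈ range (K + 1), (n₁.choose k : ℝ) * (n₂.choose (K - k) : ℝ) *
      (2 * (k : ℝ) - n₁) ^ 2 = 4 * S2 + (4 - 4 * (n₁ : ℝ)) * S1 + (n₁ : ℝ) ^ 2 * S0 := by
    rw [hS0, hS1, hS2, mul_sum, mul_sum, mul_sum, ← sum_add_distrib, ← sum_add_distrib]
    refine sum_congr rfl fun k _ => ?_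
    ring
  have h1 := first_moment n₁ n₂ K
  have h2 := second_fact_moment n₁ n₂ K
  rw [← hS0, ← hS1] at h1
  rw [← hS0, ← hS2] at h2
  have hNr : (n₁ : ℝ) + n₂ = 2 * K := by exact_mod_cast hN
  rw [hNr] at h1 h2
  rw [hsq]
  rcases Nat.eq_zero_or_pos K with hK | hK
  · -- K = 0: n₁ = n₂ = 0 and all sums are over {0}
    subst hK
    have hn1 : n₁ = 0 := by omega
    have hn2 : n₂ = 0 := by omega
    subst hn1
    subst hn2
    simp [hS0, hS1, hS2]
  have hKr : (K : ℝ) ≠ 0 := by exact_mod_cast hK.ne'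
  -- S1 = n₁ S0 / 2 and (2K - 1) S2 = n₁ (n₁ - 1) (K - 1) S0 / 2
  have h1' : 2 * S1 = (n₁ : ℝ) * S0 := by
    apply mul_left_cancel₀ hKr
    linear_combination h1
  have h2' : 2 * ((2 * (K : ℝ) - 1) * S2) = (n₁ : ℝ) * ((n₁ : ℝ) - 1) * ((K : ℝ) - 1) * S0 := by
    apply mul_left_cancel₀ hKr
    linear_combination h2
  have hn2r : (n₂ : ℝ) = 2 * K - n₁ := by linarith
  rw [hn2r]
  linear_combination 2 * h2' + (2 * (K : ℝ) - 1) * (2 - 2 * (n₁ : ℝ)) * h1'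

end HypMoments

end Summit.CriticalPhenomena.PercolationContinuityZ3.Theorems
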